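import Literature.Analysis.FluidPDE.BourgainPavlovicPairs
import Mathlib.Analysis.Convolution
import HarnessLib

/-!
# The resonant pair interactions of the Bourgain–Pavlović pieces

Sixth support file for the discharge of the barrier
`Literature.Barriers.NavierStokesRegularity.CriticalBesovNormInflation` (Bourgain–Pavlović 2008,
Thm. 1.1). The pieces of the free evolution are `i ×` real (`BourgainPavlovicPieces`), the
symbol of the tree's nonlinearity `nonlin` is real, so every pair interaction
`pairTerm a b = duhamelBilin (4π²) Uᶜ_a Uᶜ_b` (`BourgainPavlovicPairs`) is `2πi ×` a real time
integral of a real frequency integral. This file makes that structure explicit and isolates the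
pairs that feed the low mode `η = e₀` (Bourgain–Pavlović's resonant interaction
`k_s + (−k'_s) = η`, §3.2, the term `N₁` of their decomposition):

* the real **pair kernel** `pairKer a b r ξ η'` (heat factors × the contraction of the Leray
  derivative symbol with the two polarisations) and its `η'`-integral `pairG`, with
  `nonlin (Uᶜ_a r) (Uᶜ_b r) ξ l = 2πi · pairG a b l r ξ` (`nonlin_freePieceC_apply`) and
  `pairTerm a b T ξ l = 2πi · pairGT a b l T ξ`, `pairGT = ∫₀ᵀ e^{-4π²‖ξ‖²(T-r)} pairG dr`
  (`pairTerm_apply`); in particular `Re (pairTerm a b T ξ l) = 0` and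
  `Re (secondIterate T ξ l) = 0`;
* **supports**: `pairKer`, `pairG`, `pairGT` vanish unless `‖ξ − (c_a + c_b)‖ < 2ρ`; the second
  iterate vanishes on the part `2ρ ≤ ‖ξ‖ ≤ 6`, `2ρ ≤ ‖ξ ∓ η‖` of the low shell
  (`secondIterate_eq_zero_of_shell`);
* **resonance**: `c_a + c_b = η` iff `(a, b)` is one of the two ordered resonant pairs
  `(k_s, −k'_s)`, `(−k'_s, k_s)` of a common scale (`center_add_center_eq_η_iff`), and for
  `‖ξ − η‖ < 2ρ` the double sum over pairs collapses to the sum over scales of these two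
  (`secondIterate_apply_of_near_η`).

The quantitative lower bound for the resonant kernels is the object of the next file.

## References

* J. Bourgain, N. Pavlović, J. Funct. Anal. 255 (2008), §3.2, (3.5)–(3.8). [BourgainPavlovic2008]
-/

noncomputable section

open MeasureTheory Real Set Filter Topology Function Complex intervalIntegral
open scoped ComplexConjugate ENNReal NNReal Convolution

namespace Literature.Analysis.FluidPDE.BourgainPavlovic

open FourierNS Literature.Analysis.FunctionSpaces

/-- Local notation for frequency space `ℝ³`. -/
local notation "E3" => EuclideanSpace ℝ (Fin 3)

/-! ### The real contraction of the symbol with two polarisations -/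

/-- **The contraction** of the Leray derivative symbol (output component `l`) with two real
vectors: `contr l ξ u v = ∑_{j,k} ξ_j (δ_{kl} − ξ_k ξ_l/‖ξ‖²) u_j v_k
= (ξ·u) (v_l − ξ_l (ξ·v)/‖ξ‖²)`. [folklore] -/
def contr (l : Fin 3) (ξ : E3) (u v : Fin 3 → ℝ) : ℝ := ∑ j, ∑ k, lerayDerivSymbol j k l ξ * (u j * v k)

/-- The factorised form of the contraction. [folklore] -/
theorem contr_eq (l : Fin 3) (ξ : E3) (u v : Fin 3 → ℝ) :
    contr l ξ u v = (∑ j, ξ j * u j) * (v l - ξ l * (∑ k, ξ k * v k) / ‖ξ‖ ^ 2) := by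
  fin_cases l <;> simp [contr, Fin.sum_univ_three, lerayDerivSymbol_apply] <;> ring

/-- The contraction is homogeneous in each vector. [folklore] -/
theorem contr_smul_smul (l : Fin 3) (ξ : E3) (c₁ c₂ : ℝ) (u v : Fin 3 → ℝ) :
    contr l ξ (fun j => c₁ * u j) (fun k => c₂ * v k) = c₁ * c₂ * contr l ξ u v := by
  simp only [contr, Finset.mul_sum]
  refine Finset.sum_congr rfl fun j _ => Finset.sum_congr rfl fun k _ => ?_
  ring

/-- Continuity in time of the nonlinearity of two jointly continuous, uniformly decaying
families, at a fixed frequency. [folklore] -/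
theorem _root_.Literature.Analysis.FluidPDE.FourierNS.continuous_nonlin_slice {ι : Type*} [Fintype ι]
    [DecidableEq ι] {K₀ : ℕ} (hK₀ : Fintype.card ι < K₀) {v w : ℝ → EuclideanSpace ℝ ι → ι → ℂ}
    {A B : ℝ} (hvc : Continuous (uncurry v)) (hwc : Continuous (uncurry w))
    (hv : ∀ t, HasDecay K₀ A (v t)) (hw : ∀ t, HasDecay K₀ B (w t)) (ξ : EuclideanSpace ℝ ι) :
    Continuous fun r => nonlin (v r) (w r) ξ :=
  continuous_nonlin_param (X := ℝ) hK₀ (V := fun r => v r) (W := fun r => w r) (ζ := fun _ => ξ)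
    (fun r => (hvc.uncurry_left r).aestronglyMeasurable)
    (fun r => (hwc.uncurry_left r).aestronglyMeasurable) (fun r => hv r) (fun r => hw r)
    (fun _ => hvc.comp (continuous_id.prodMk continuous_const))
    (fun _ => hwc.comp (continuous_id.prodMk continuous_const)) continuous_const

namespace InflationParams

variable (d : InflationParams)

/-! ### The pair kernel and the structure `pairTerm = 2πi × real` -/

/-- **The pair kernel** (real): heat factors of the two pieces at the clamped time times the
contraction of the symbol with the two real pieces,
`e^{-4π²‖η'‖² r⁺} e^{-4π²‖ξ-η'‖² r⁺} contr_l(ξ; pieceR a η', pieceR b (ξ − η'))`. [cite: BourgainPavlovic2008, §3.2 (the integrand of `N₁`, `N₂`, `N₃`)] -/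
def pairKer (a b : ℕ × Bool × Bool) (l : Fin 3) (r : ℝ) (ξ η' : E3) : ℝ :=
  heat (4 * π ^ 2) η' (max r 0) * heat (4 * π ^ 2) (ξ - η') (max r 0) *
    contr l ξ (d.pieceR a η') (d.pieceR b (ξ - η'))

/-- **The pair frequency integral** `pairG a b l r ξ = ∫ pairKer a b l r ξ η' dη'`. [folklore] -/
def pairG (a b : ℕ × Bool × Bool) (l : Fin 3) (r : ℝ) (ξ : E3) : ℝ := ∫ η', d.pairKer a b l r ξ η'

/-- **The pair time integral** `pairGT a b l T ξ = ∫₀ᵀ e^{-4π²‖ξ‖²(T-r)} pairG a b l r ξ dr`. [folklore] -/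
def pairGT (a b : ℕ × Bool × Bool) (l : Fin 3) (T : ℝ) (ξ : E3) : ℝ :=
  ∫ r in (0 : ℝ)..T, heat (4 * π ^ 2) ξ (T - r) * d.pairG a b l r ξ

/-- The real factor of a clamped piece: `Uᶜ_a(r, η')_j = i · X`,
`X = e^{-4π²‖η'‖² r⁺} pieceR a η' j`. [folklore] -/
theorem freePieceC_apply (a : ℕ × Bool × Bool) (r : ℝ) (η' : E3) (j : Fin 3) :
    d.freePieceC a r η' j =
      Complex.I * ((heat (4 * π ^ 2) η' (max r 0) * d.pieceR a η' j : ℝ) : ℂ) := rfl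

/-- The real pieces vanish outside the ball of radius `N_s + 2` (crude support). [folklore] -/
theorem pieceR_eq_zero_of_le {a : ℕ × Bool × Bool} {η' : E3} (h : d.N a.1 + 2 ≤ ‖η'‖) (j : Fin 3) :
    d.pieceR a η' j = 0 := by
  by_contra hne
  have := (d.norm_bounds_of_norm_sub_center_lt (d.norm_sub_center_lt_of_pieceR_ne_zero hne)).2
  linarith

/-- The real pieces are continuous. [folklore] -/
theorem continuous_pieceR (a : ℕ × Bool × Bool) (j : Fin 3) : Continuous fun η' : E3 => d.pieceR a η' j := by
  simp only [pieceR]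
  exact continuous_const.mul ((d.continuous_ψ.comp (continuous_id.sub continuous_const)).mul
    (continuous_pol a.2.2 j))

/-- The product integrand `X_j(η') Y_k(ξ − η')` of a pair is continuous with compact support,
hence integrable. [folklore] -/
theorem integrable_pieceProd (a b : ℕ × Bool × Bool) (r : ℝ) (ξ : E3) (j k : Fin 3) :
    Integrable fun η' : E3 => (heat (4 * π ^ 2) η' (max r 0) * d.pieceR a η' j) *
      (heat (4 * π ^ 2) (ξ - η') (max r 0) * d.pieceR b (ξ - η') k) := by
  have hc : Continuous fun η' : E3 => (heat (4 * π ^ 2) η' (max r 0) * d.pieceR a η' j) *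
      (heat (4 * π ^ 2) (ξ - η') (max r 0) * d.pieceR b (ξ - η') k) :=
    ((continuous_heat_comp _ continuous_id continuous_const).mul (d.continuous_pieceR a j)).mul
      ((continuous_heat_comp _ (continuous_const.sub continuous_id) continuous_const).mul
        ((d.continuous_pieceR b k).comp (continuous_const.sub continuous_id)))
  refine hc.integrable_of_hasCompactSupport ?_
  refine HasCompactSupport.intro (isCompact_closedBall (0 : E3) (d.N a.1 + 2)) fun η' hη' => ?_
  rw [Metric.mem_closedBall, dist_zero_right, not_le] at hη'
  simp [d.pieceR_eq_zero_of_le hη'.le]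

/-- The pair kernel is integrable in `η'`. [folklore] -/
theorem integrable_pairKer (a b : ℕ × Bool × Bool) (l : Fin 3) (r : ℝ) (ξ : E3) :
    Integrable fun η' => d.pairKer a b l r ξ η' := by
  have : (fun η' => d.pairKer a b l r ξ η') = fun η' => ∑ j, ∑ k, lerayDerivSymbol j k l ξ *
      ((heat (4 * π ^ 2) η' (max r 0) * d.pieceR a η' j) *
        (heat (4 * π ^ 2) (ξ - η') (max r 0) * d.pieceR b (ξ - η') k)) := by
    funext η'
    simp only [pairKer, contr, Finset.mul_sum]
    refine Finset.sum_congr rfl fun j _ => Finset.sum_congr rfl fun k _ => ?_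
    ring
  rw [this]
  refine integrable_finsetSum _ fun j _ => integrable_finsetSum _ fun k _ => ?_
  exact (d.integrable_pieceProd a b r ξ j k).const_mul _

/-- **The convolution of two clamped pieces is minus a real integral**:
`(Uᶜ_{a,j}(r) ⋆ Uᶜ_{b,k}(r))(ξ) = −∫ X_j(η') Y_k(ξ − η') dη'` (`i · i = −1`). [folklore] -/
theorem fconv_freePieceC (a b : ℕ × Bool × Bool) (r : ℝ) (ξ : E3) (j k : Fin 3) :
    fconv (fun η' => d.freePieceC a r η' j) (fun η' => d.freePieceC b r η' k) ξ =
      -Complex.ofReal (∫ η', (heat (4 * π ^ 2) η' (max r 0) * d.pieceR a η' j) *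
        (heat (4 * π ^ 2) (ξ - η') (max r 0) * d.pieceR b (ξ - η') k)) := by
  rw [fconv_apply]
  simp only [freePieceC_apply]
  have : ∀ η' : E3, Complex.I * ((heat (4 * π ^ 2) η' (max r 0) * d.pieceR a η' j : ℝ) : ℂ) *
      (Complex.I * ((heat (4 * π ^ 2) (ξ - η') (max r 0) * d.pieceR b (ξ - η') k : ℝ) : ℂ)) =
      -Complex.ofReal ((heat (4 * π ^ 2) η' (max r 0) * d.pieceR a η' j) *
        (heat (4 * π ^ 2) (ξ - η') (max r 0) * d.pieceR b (ξ - η') k)) := fun η' => by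
    have hI : Complex.I * Complex.I = -1 := Complex.I_mul_I
    push_cast
    linear_combination ((heat (4 * π ^ 2) η' (max r 0) : ℂ) * (d.pieceR a η' j : ℂ) *
      ((heat (4 * π ^ 2) (ξ - η') (max r 0) : ℂ) * (d.pieceR b (ξ - η') k : ℂ))) * hI
  simp_rw [this]
  rw [MeasureTheory.integral_neg, integral_complex_ofReal]

/-- `pairG` as a double sum of real integrals. [folklore] -/
theorem pairG_eq_sum (a b : ℕ × Bool × Bool) (l : Fin 3) (r : ℝ) (ξ : E3) :
    d.pairG a b l r ξ = ∑ j, ∑ k, lerayDerivSymbol j k l ξ *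
      ∫ η', (heat (4 * π ^ 2) η' (max r 0) * d.pieceR a η' j) *
        (heat (4 * π ^ 2) (ξ - η') (max r 0) * d.pieceR b (ξ - η') k) := by
  rw [pairG]
  have : (fun η' => d.pairKer a b l r ξ η') = fun η' => ∑ j, ∑ k, lerayDerivSymbol j k l ξ *
      ((heat (4 * π ^ 2) η' (max r 0) * d.pieceR a η' j) *
        (heat (4 * π ^ 2) (ξ - η') (max r 0) * d.pieceR b (ξ - η') k)) := by
    funext η'
    simp only [pairKer, contr, Finset.mul_sum]
    refine Finset.sum_congr rfl fun j _ => Finset.sum_congr rfl fun k _ => ?_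
    ring
  rw [this, integral_finsetSum _ fun j _ => integrable_finsetSum _ fun k _ =>
    (d.integrable_pieceProd a b r ξ j k).const_mul _]
  refine Finset.sum_congr rfl fun j _ => ?_
  rw [integral_finsetSum _ fun k _ => (d.integrable_pieceProd a b r ξ j k).const_mul _]
  refine Finset.sum_congr rfl fun k _ => ?_
  rw [MeasureTheory.integral_const_mul]

/-- **The pair nonlinearity is `2πi ×` the real pair integral**:
`nonlin (Uᶜ_a r) (Uᶜ_b r) ξ l = 2πi · pairG a b l r ξ`. [cite: BourgainPavlovic2008, §3.2] -/
theorem nonlin_freePieceC_apply (a b : ℕ × Bool × Bool) (r : ℝ) (ξ : E3) (l : Fin 3) :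
    nonlin (d.freePieceC a r) (d.freePieceC b r) ξ l = 2 * π * Complex.I * (d.pairG a b l r ξ : ℂ) := by
  rw [nonlin_apply]
  simp only [d.fconv_freePieceC, d.pairG_eq_sum]
  push_cast
  simp only [mul_neg, Finset.sum_neg_distrib]
  ring

/-- `pairG` is continuous in `r` (parametric integral of a jointly continuous, locally uniformly
compactly supported integrand), in the form needed for the time integral: the function
`r ↦ nonlin (Uᶜ_a r) (Uᶜ_b r) ξ l` is continuous. [folklore] -/
theorem continuous_nonlin_freePieceC (a b : ℕ × Bool × Bool) (ξ : E3) :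
    Continuous fun r => nonlin (d.freePieceC a r) (d.freePieceC b r) ξ :=
  continuous_nonlin_slice card_fin_three_lt_four (d.continuous_freePieceC a) (d.continuous_freePieceC b)
    (fun r => d.hasDecay_freePieceC a r 4) (fun r => d.hasDecay_freePieceC b r 4) ξ

/-- `r ↦ pairG a b l r ξ` is continuous. [folklore] -/
theorem continuous_pairG (a b : ℕ × Bool × Bool) (l : Fin 3) (ξ : E3) :
    Continuous fun r => d.pairG a b l r ξ := by
  have h := (continuous_apply l).comp (d.continuous_nonlin_freePieceC a b ξ)
  have h2 : Continuous fun r => (nonlin (d.freePieceC a r) (d.freePieceC b r) ξ l) / (2 * π * Complex.I) :=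
    h.div_const _
  have hne : (2 * π * Complex.I : ℂ) ≠ 0 := by simp [Real.pi_ne_zero, Complex.I_ne_zero]
  have h3 : (fun r => (d.pairG a b l r ξ : ℂ)) =
      fun r => (nonlin (d.freePieceC a r) (d.freePieceC b r) ξ l) / (2 * π * Complex.I) := by
    funext r
    rw [d.nonlin_freePieceC_apply, eq_div_iff hne, mul_comm]
  have h4 : Continuous fun r => (d.pairG a b l r ξ : ℂ) := by rw [h3]; exact h2
  exact Complex.continuous_re.comp h4 |>.congr fun r => by simp

/-- **The pair interaction is `2πi ×` the real pair time integral**: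
`pairTerm a b T ξ l = 2πi · pairGT a b l T ξ`. [cite: BourgainPavlovic2008, §3.2] -/
theorem pairTerm_apply (a b : ℕ × Bool × Bool) (T : ℝ) (ξ : E3) (l : Fin 3) :
    d.pairTerm a b T ξ l = 2 * π * Complex.I * (d.pairGT a b l T ξ : ℂ) := by
  rw [pairTerm, duhamelBilin_apply, pairGT]
  have hint : IntervalIntegrable (fun r => heat (4 * π ^ 2) ξ (T - r) •
      nonlin (d.freePieceC a r) (d.freePieceC b r) ξ) volume 0 T :=
    ((continuous_heat_comp _ continuous_const (continuous_const.sub continuous_id)).smul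
      (d.continuous_nonlin_freePieceC a b ξ)).intervalIntegrable _ _
  have hproj := ((ContinuousLinearMap.proj (R := ℂ) (φ := fun _ : Fin 3 => ℂ) l).intervalIntegral_comp_comm
    hint).symm
  simp only [ContinuousLinearMap.proj_apply] at hproj
  rw [hproj]
  simp only [Pi.smul_apply, d.nonlin_freePieceC_apply, Complex.real_smul]
  rw [← intervalIntegral.integral_ofReal, ← intervalIntegral.integral_const_mul]
  refine intervalIntegral.integral_congr fun r _ => ?_
  push_cast
  ring

/-- **The pair interactions are purely imaginary**: `Re (pairTerm a b T ξ l) = 0`. [folklore] -/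
theorem pairTerm_re (a b : ℕ × Bool × Bool) (T : ℝ) (ξ : E3) (l : Fin 3) :
    (d.pairTerm a b T ξ l).re = 0 := by
  rw [pairTerm_apply]
  simp

/-- `Im (pairTerm a b T ξ l) = 2π · pairGT a b l T ξ`. [folklore] -/
theorem pairTerm_im (a b : ℕ × Bool × Bool) (T : ℝ) (ξ : E3) (l : Fin 3) :
    (d.pairTerm a b T ξ l).im = 2 * π * d.pairGT a b l T ξ := by
  rw [pairTerm_apply]
  simp

/-- **The second iterate is purely imaginary**: `Re (u₁(T, ξ)_l) = 0`. [folklore] -/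
theorem secondIterate_re (T : ℝ) (ξ : E3) (l : Fin 3) : (d.secondIterate T ξ l).re = 0 := by
  rw [secondIterate_eq_sum, Finset.sum_apply, Complex.re_sum]
  refine Finset.sum_eq_zero fun a _ => ?_
  rw [Finset.sum_apply, Complex.re_sum]
  exact Finset.sum_eq_zero fun b _ => d.pairTerm_re a b T ξ l

/-- `Im (u₁(T, ξ)_l) = 2π ∑_{a,b} pairGT a b l T ξ`. [folklore] -/
theorem secondIterate_im (T : ℝ) (ξ : E3) (l : Fin 3) :
    (d.secondIterate T ξ l).im = 2 * π * ∑ a ∈ d.idx, ∑ b ∈ d.idx, d.pairGT a b l T ξ := by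
  rw [secondIterate_eq_sum, Finset.sum_apply, Complex.im_sum, Finset.mul_sum]
  refine Finset.sum_congr rfl fun a _ => ?_
  rw [Finset.sum_apply, Complex.im_sum, Finset.mul_sum]
  exact Finset.sum_congr rfl fun b _ => d.pairTerm_im a b T ξ l

/-! ### Supports -/

/-- The pair kernel vanishes identically off the output ball. [folklore] -/
theorem pairKer_eq_zero {a b : ℕ × Bool × Bool} (l : Fin 3) (r : ℝ) {ξ : E3}
    (hξ : 2 * d.ρ ≤ ‖ξ - (d.center a + d.center b)‖) (η' : E3) : d.pairKer a b l r ξ η' = 0 := by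
  have hz : ∀ j k, d.pieceR a η' j * d.pieceR b (ξ - η') k = 0 := by
    intro j k
    by_contra hne
    have ha : d.pieceR a η' j ≠ 0 := left_ne_zero_of_mul hne
    have hb : d.pieceR b (ξ - η') k ≠ 0 := right_ne_zero_of_mul hne
    have h1 := d.norm_sub_center_lt_of_pieceR_ne_zero ha
    have h2 := d.norm_sub_center_lt_of_pieceR_ne_zero hb
    have : ‖ξ - (d.center a + d.center b)‖ < 2 * d.ρ := by
      calc ‖ξ - (d.center a + d.center b)‖ = ‖(η' - d.center a) + (ξ - η' - d.center b)‖ := by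
            congr 1; abel
        _ ≤ ‖η' - d.center a‖ + ‖ξ - η' - d.center b‖ := norm_add_le _ _
        _ < d.ρ + d.ρ := add_lt_add h1 h2
        _ = 2 * d.ρ := by ring
    linarith
  simp only [pairKer, contr, hz, mul_zero, Finset.sum_const_zero]

/-- `pairG` vanishes off the output ball. [folklore] -/
theorem pairG_eq_zero {a b : ℕ × Bool × Bool} (l : Fin 3) (r : ℝ) {ξ : E3}
    (hξ : 2 * d.ρ ≤ ‖ξ - (d.center a + d.center b)‖) : d.pairG a b l r ξ = 0 := by
  rw [pairG]
  simp [d.pairKer_eq_zero l r hξ]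

/-- `pairGT` vanishes off the output ball. [folklore] -/
theorem pairGT_eq_zero {a b : ℕ × Bool × Bool} (l : Fin 3) (T : ℝ) {ξ : E3}
    (hξ : 2 * d.ρ ≤ ‖ξ - (d.center a + d.center b)‖) : d.pairGT a b l T ξ = 0 := by
  rw [pairGT]
  simp [d.pairG_eq_zero l _ hξ]

/-- **The second iterate vanishes on the low shell away from `±η`**: if `2ρ ≤ ‖ξ‖ ≤ 6` and
`2ρ ≤ ‖ξ − η‖`, `2ρ ≤ ‖ξ + η‖`, then `u₁(T, ξ) = 0` (a nonzero pair term needs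
`‖ξ − (c_a + c_b)‖ < 2ρ`; high pairs have `‖c_a + c_b‖ ≥ 7`, low pairs have
`c_a + c_b ∈ {0, ±η}`). [cite: BourgainPavlovic2008, §3.2 (supports of `N₁`, `N₂`, `N₃`)] -/
theorem secondIterate_eq_zero_of_shell (T : ℝ) {ξ : E3} (h0 : 2 * d.ρ ≤ ‖ξ‖) (h6 : ‖ξ‖ ≤ 6)
    (hp : 2 * d.ρ ≤ ‖ξ - η‖) (hm : 2 * d.ρ ≤ ‖ξ + η‖) : d.secondIterate T ξ = 0 := by
  rw [secondIterate_eq_sum]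
  refine Finset.sum_eq_zero fun a _ => Finset.sum_eq_zero fun b _ => d.pairTerm_eq_zero T ?_
  have hρ := d.ρ_le
  by_cases hl : IsLowPair a b
  · rw [d.center_add_center_of_low hl]
    rcases a with ⟨s, σ, τ⟩; rcases b with ⟨s', σ', τ'⟩
    cases σ <;> cases τ <;> cases τ' <;>
      simp only [sgn, Bool.false_eq_true, ↓reduceIte, sub_self, sub_zero, zero_sub, mul_one, mul_zero,
        mul_neg, one_smul, neg_smul, zero_smul, sub_zero, sub_neg_eq_add, neg_neg] <;>
      first | exact h0 | exact hp | exact hm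
  · have h7 := d.norm_center_add_center_ge_of_not_low hl
    have h8 : 8 ≤ max (d.N a.1) (d.N b.1) := le_max_of_le_left (d.eight_le_N a.1)
    have h1 : ‖d.center a + d.center b‖ - ‖ξ‖ ≤ ‖ξ - (d.center a + d.center b)‖ := by
      rw [norm_sub_rev]; exact norm_sub_norm_le _ _
    linarith

/-! ### The resonant pairs -/

/-- The resonant pair of type A at scale `s`: `(k_s, −k'_s)`. [cite: BourgainPavlovic2008, §3.2] -/
def resA (s : ℕ) : (ℕ × Bool × Bool) × (ℕ × Bool × Bool) := ((s, false, false), (s, true, true))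

/-- The resonant pair of type B at scale `s`: `(−k'_s, k_s)`. [cite: BourgainPavlovic2008, §3.2] -/
def resB (s : ℕ) : (ℕ × Bool × Bool) × (ℕ × Bool × Bool) := ((s, true, true), (s, false, false))

/-- `k_s + (−k'_s) = η`. [cite: BourgainPavlovic2008, (3.2)] -/
theorem center_add_center_resA (s : ℕ) : d.center (s, false, false) + d.center (s, true, true) = η := by
  simp [center, sgn]

/-- `(−k'_s) + k_s = η`. [cite: BourgainPavlovic2008, (3.2)] -/
theorem center_add_center_resB (s : ℕ) : d.center (s, true, true) + d.center (s, false, false) = η := by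
  simp [center, sgn]

/-- `η ≠ 0`. [folklore] -/
theorem η_ne_zero : (η : E3) ≠ 0 := by
  intro h
  have := norm_η
  rw [h, norm_zero] at this
  exact zero_ne_one this

/-- **Characterisation of the resonant pairs**: `c_a + c_b = η` iff `(a, b)` is `(k_s, −k'_s)` or
`(−k'_s, k_s)` for a common scale `s`. [cite: BourgainPavlovic2008, §3.2] -/
theorem center_add_center_eq_η_iff (a b : ℕ × Bool × Bool) :
    d.center a + d.center b = η ↔
      a.1 = b.1 ∧ ((a.2 = (false, false) ∧ b.2 = (true, true)) ∨ (a.2 = (true, true) ∧ b.2 = (false, false))) := by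
  constructor
  · intro h
    have hl : IsLowPair a b := by
      by_contra hnl
      have h7 := d.norm_center_add_center_ge_of_not_low hnl
      have h8 : 8 ≤ max (d.N a.1) (d.N b.1) := le_max_of_le_left (d.eight_le_N a.1)
      rw [h, norm_η] at h7
      linarith
    refine ⟨hl.1, ?_⟩
    rw [d.center_add_center_of_low hl] at h
    have hcoef : sgn a.2.1 * ((if b.2.2 then (1 : ℝ) else 0) - (if a.2.2 then 1 else 0)) = 1 := by
      have h' := h
      nth_rw 2 [← one_smul ℝ (η : E3)] at h'
      exact smul_left_injective ℝ η_ne_zero h'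
    rcases a with ⟨s, σ, τ⟩; rcases b with ⟨s', σ', τ'⟩
    obtain ⟨_, hσ⟩ := hl
    simp only at hσ hcoef ⊢
    cases σ <;> cases σ' <;> cases τ <;> cases τ' <;> simp [sgn] at hσ hcoef ⊢ <;> norm_num at hcoef
  · rintro ⟨hs, (⟨ha, hb⟩ | ⟨ha, hb⟩)⟩
    · rcases a with ⟨s, u⟩; rcases b with ⟨s', u'⟩
      simp only at hs ha hb; subst hs; subst ha; subst hb
      exact d.center_add_center_resA s
    · rcases a with ⟨s, u⟩; rcases b with ⟨s', u'⟩
      simp only at hs ha hb; subst hs; subst ha; subst hb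
      exact d.center_add_center_resB s

/-- Near `η`, a non-resonant pair does not contribute: if `‖ξ − η‖ < 2ρ` and `c_a + c_b ≠ η`
then `2ρ ≤ ‖ξ − (c_a + c_b)‖` (the other possible sums of centres are at distance `≥ 1` from
`η`, and `4ρ < 1`). [folklore] -/
theorem two_rho_le_of_ne_η {a b : ℕ × Bool × Bool} (h : d.center a + d.center b ≠ η) {ξ : E3}
    (hξ : ‖ξ - η‖ < 2 * d.ρ) : 2 * d.ρ ≤ ‖ξ - (d.center a + d.center b)‖ := by
  have hρ := d.ρ_le
  -- distance from `η` to the sum of centres is at least `1`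
  have hdist : 1 ≤ ‖(η : E3) - (d.center a + d.center b)‖ := by
    by_cases hl : IsLowPair a b
    · rw [d.center_add_center_of_low hl] at h ⊢
      set t : ℝ := sgn a.2.1 * ((if b.2.2 then (1 : ℝ) else 0) - (if a.2.2 then 1 else 0)) with ht
      have ht1 : t ≠ 1 := by
        intro h1; apply h; rw [h1, one_smul]
      have hvals : t = -1 ∨ t = 0 ∨ t = 1 := by
        rcases a with ⟨s, σ, τ⟩; rcases b with ⟨s', σ', τ'⟩
        cases σ <;> cases τ <;> cases τ' <;> simp [ht, sgn]
      have : (η : E3) - t • η = (1 - t) • η := by rw [sub_smul, one_smul]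
      rw [this, norm_smul, norm_η, mul_one, Real.norm_eq_abs]
      rcases hvals with h1 | h1 | h1
      · rw [h1]; norm_num
      · rw [h1]; norm_num
      · exact absurd h1 ht1
    · have h7 := d.norm_center_add_center_ge_of_not_low hl
      have h8 : 8 ≤ max (d.N a.1) (d.N b.1) := le_max_of_le_left (d.eight_le_N a.1)
      have : ‖d.center a + d.center b‖ - ‖(η : E3)‖ ≤ ‖(η : E3) - (d.center a + d.center b)‖ := by
        rw [norm_sub_rev]; exact norm_sub_norm_le _ _
      rw [norm_η] at this
      linarith
  have htri : ‖(η : E3) - (d.center a + d.center b)‖ ≤ ‖ξ - η‖ + ‖ξ - (d.center a + d.center b)‖ := by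
    calc ‖(η : E3) - (d.center a + d.center b)‖ = ‖(ξ - (d.center a + d.center b)) - (ξ - η)‖ := by
          congr 1; abel
      _ ≤ ‖ξ - (d.center a + d.center b)‖ + ‖ξ - η‖ := norm_sub_le _ _
      _ = _ := add_comm _ _
  linarith

/-- **Collapse of the pair sum near `η`**: for `‖ξ − η‖ < 2ρ`,
`∑_{a,b} pairGT a b l T ξ = ∑_{s<r} (pairGT (k_s) (−k'_s) + pairGT (−k'_s) (k_s))`. [cite: BourgainPavlovic2008, §3.2 (only `N₁` reaches the mode `η`)] -/
theorem sum_pairGT_of_near_η (l : Fin 3) (T : ℝ) {ξ : E3} (hξ : ‖ξ - η‖ < 2 * d.ρ) :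
    ∑ a ∈ d.idx, ∑ b ∈ d.idx, d.pairGT a b l T ξ =
      ∑ s ∈ Finset.range d.r, (d.pairGT (s, false, false) (s, true, true) l T ξ +
        d.pairGT (s, true, true) (s, false, false) l T ξ) := by
  classical
  have hvan : ∀ a b, d.center a + d.center b ≠ η → d.pairGT a b l T ξ = 0 := fun a b h =>
    d.pairGT_eq_zero l T (d.two_rho_le_of_ne_η h hξ)
  have hne : ∀ a b, ¬(a.1 = b.1 ∧ ((a.2 = (false, false) ∧ b.2 = (true, true)) ∨
      (a.2 = (true, true) ∧ b.2 = (false, false)))) → d.pairGT a b l T ξ = 0 := fun a b h =>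
    hvan a b (fun he => h ((d.center_add_center_eq_η_iff a b).1 he))
  rw [idx, Finset.sum_product]
  refine Finset.sum_congr rfl fun s hs => ?_
  -- for fixed scale `s` and pattern `u`, only `b = (s, partner u)` survives
  have hinner : ∀ u : Bool × Bool, ∑ b ∈ Finset.range d.r ×ˢ (Finset.univ ×ˢ Finset.univ), d.pairGT (s, u) b l T ξ =
      ∑ u' ∈ (Finset.univ ×ˢ Finset.univ : Finset (Bool × Bool)), d.pairGT (s, u) (s, u') l T ξ := by
    intro u
    rw [Finset.sum_product, Finset.sum_eq_single_of_mem s hs]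
    intro s' _ hs'
    exact Finset.sum_eq_zero fun u' _ => hne _ _ (fun h => hs' h.1.symm)
  simp_rw [hinner]
  rw [← Finset.sum_product']
  rw [Finset.sum_eq_add_of_mem ((false, false), (true, true)) ((true, true), (false, false))
    (by simp) (by simp) (by decide)]
  rintro ⟨u, u'⟩ _ huu
  apply hne
  rintro ⟨_, (⟨hu, hu'⟩ | ⟨hu, hu'⟩)⟩ <;> simp only at hu hu' <;> subst hu <;> subst hu' <;> simp at huu

/-- **The second iterate near `η`**: for `‖ξ − η‖ < 2ρ`, `Re u₁(T,ξ)_l = 0` and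
`Im u₁(T,ξ)_l = 2π ∑_{s<r} (pairGT (k_s)(−k'_s) + pairGT (−k'_s)(k_s))`. [cite: BourgainPavlovic2008, §3.2, (3.6)–(3.8)] -/
theorem secondIterate_im_of_near_η (l : Fin 3) (T : ℝ) {ξ : E3} (hξ : ‖ξ - η‖ < 2 * d.ρ) :
    (d.secondIterate T ξ l).im = 2 * π * ∑ s ∈ Finset.range d.r,
      (d.pairGT (s, false, false) (s, true, true) l T ξ + d.pairGT (s, true, true) (s, false, false) l T ξ) := by
  rw [secondIterate_im, d.sum_pairGT_of_near_η l T hξ]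

end InflationParams

end Literature.Analysis.FluidPDE.BourgainPavlovic
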